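import Summits.CriticalPhenomena.PercolationContinuityZ3.Theorems.PercNearOneGluingNoHeavyLowerTailSahiC3CubeEvents

/-!
# The tangent inequality `T₃ = E₃ − ∂E₃ ≥ 0` on the Boolean cube `{0,1}^m × Bool`, every product measure — a kernel-checkable
# certificate (Sahi programme, cell prim-sahi, prover prim-sahi-p2 gen 32)

Support file (`--supports stmt-CriticalPhenomena-4575`).  No named facts, no sorries; standard axioms.  Continues
`…SahiC3CubeCertCheck` / `…SahiC3CubeEvents` (seat prim-sahi-p1: bitmask tables, Kronecker digit test, the `E₃` cube check) with a
second target functional.  Memo `run/shared/lean/prim/prim-sahi/FROM-prim-sahi-p2-gen32-TANGENT.md` §2/§6, `prim-sahi-p2/PROOF-E3.md` §42.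

For a product measure `μ_p` on `{0,1}^m` (`p ∈ [0,1]^m`) and six events `A₀, A₁, B₀, B₁, C₀, C₁ ⊆ Set (Fin m)` the TANGENT functional is

  `T₃ = 2μ(A₀B₀C₀) + Σ_cyc (μA₁ − μA₀)·μ(B₁C₁) + Σ_cyc μA₀·μB₁·μC₁ − Σ_cyc μA₁·μ(B₀C₀) − 2·μA₁μB₁μC₁`.

When `A₀ ⊆ A₁, B₀ ⊆ B₁, C₀ ⊆ C₁` are increasing, `(A₀,A₁)` is the pair of sections of a general increasing event of `{0,1}^m × Bool`, and
`T₃ = E(1) − E′(1)` for the cubic `q ↦ E(q) = E₃` under `μ_p ⊗ B_q` (`…SahiTangentChain`, `SahiTangent.sahiE_three_sections`); in bond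
percolation it is the R23 margin of the increasing-star programme (`IncStar.incStar_nonneg_of_ratio23`).  CONJECTURE T (memo §0): `T₃ ≥ 0` for
every product measure and all increasing section pairs.  Here, exactly as for `E₃` in `…SahiC3CubeCertCheck`:

* `zT3`, `checkSix`, `checkSix_sound` — `T₃` is a signed sum of fourteen products of three multilinear polynomials of bitmask tables
  (`cubicForm` with `Σ|signs| = 16`), so it is `≥ 0` on `[0,1]^m` as soon as its `4^m` tensor-Bernstein coefficients are — the base-`2^σ`
  digits of one Kronecker number (`16·8^m < 2^(σ−1)`);
* `pairsN`, `checkCubeT m σ` — the test over all sorted triples of increasing bitmask PAIRS `(A₀ ⊆ A₁)` (`T₃` is symmetric in the three pairs);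
* `tangent_nonneg_of_checkSix`, **`tangent_cube_nonneg_of_checkCubeT`** — the bridge to `prodBernoulli p` on `Set (Fin m)`.

Evaluations (`m ≤ 2` kernel `decide`; `m = 3`, 804 440 sorted triples, by compiled evaluation) are in `…SahiTangentCubeLeThree`.
-/

namespace Summit.CriticalPhenomena.PercolationContinuityZ3.Theorems.SahiTangent

open Finset MeasureTheory OneCutCert CovTransferCert SahiC3Cube
open scoped BigOperators
open Literature.Probability.Percolation Literature.Probability.LatticeModels

/-! ## The certificate number of `T₃` and the digit test -/

/-- The certificate number of `T₃` (fourteen Kronecker products; `F` = the number of the whole cube). [this work] -/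
def zT3 (σ m : ℕ) (F : ℤ) (A₀ A₁ B₀ B₁ C₀ C₁ : ℕ) : ℤ :=
  2 * (krT σ m (A₀ &&& B₀ &&& C₀) : ℤ) * F * F
    + (krT σ m A₁ : ℤ) * (krT σ m (B₁ &&& C₁) : ℤ) * F - (krT σ m A₀ : ℤ) * (krT σ m (B₁ &&& C₁) : ℤ) * F
    + (krT σ m A₀ : ℤ) * (krT σ m B₁ : ℤ) * (krT σ m C₁ : ℤ) - (krT σ m A₁ : ℤ) * (krT σ m (B₀ &&& C₀) : ℤ) * F
    + (krT σ m B₁ : ℤ) * (krT σ m (A₁ &&& C₁) : ℤ) * F - (krT σ m B₀ : ℤ) * (krT σ m (A₁ &&& C₁) : ℤ) * F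
    + (krT σ m B₀ : ℤ) * (krT σ m A₁ : ℤ) * (krT σ m C₁ : ℤ) - (krT σ m B₁ : ℤ) * (krT σ m (A₀ &&& C₀) : ℤ) * F
    + (krT σ m C₁ : ℤ) * (krT σ m (A₁ &&& B₁) : ℤ) * F - (krT σ m C₀ : ℤ) * (krT σ m (A₁ &&& B₁) : ℤ) * F
    + (krT σ m C₀ : ℤ) * (krT σ m A₁ : ℤ) * (krT σ m B₁ : ℤ) - (krT σ m C₁ : ℤ) * (krT σ m (A₀ &&& B₀) : ℤ) * F
    - 2 * (krT σ m A₁ : ℤ) * (krT σ m B₁ : ℤ) * (krT σ m C₁ : ℤ)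

/-- The digit test of one six-tuple with precomputed full-cube number `F`, offset `off` and its `toNat`. [this work] -/
def checkSixW (σ m : ℕ) (F off : ℤ) (offN : ℕ) (A₀ A₁ B₀ B₁ C₀ C₁ : ℕ) : Bool :=
  let Z := zT3 σ m F A₀ A₁ B₀ B₁ C₀ C₁ + off
  decide (0 ≤ Z) && decide ((Z.toNat &&& offN) = offN)

/-- The certificate CHECK of one six-tuple of bitmasks in base `2^σ`: coefficient bound `16·8^m < 2^(σ-1)` and the AND-mask digit test. [this work] -/
def checkSix (σ m A₀ A₁ B₀ B₁ C₀ C₁ : ℕ) : Bool :=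
  decide (0 < σ) && decide (16 * 8 ^ m < 2 ^ (σ - 1)) &&
    checkSixW σ m (krT σ m (fullN m)) (offT σ m) (offT σ m).toNat A₀ A₁ B₀ B₁ C₀ C₁

/-- The signs of the fourteen cubic terms of `T₃`. [this work] -/
def sgn14 : Fin 14 → ℤ := ![2, 1, -1, 1, -1, 1, -1, 1, -1, 1, -1, 1, -1, -2]

/-- First factors. [this work] -/
def X14 (m A₀ A₁ B₀ B₁ C₀ C₁ : ℕ) : Fin 14 → (Fin m → Bool) → ℤ :=
  ![tabZ m (A₀ &&& B₀ &&& C₀), tabZ m A₁, tabZ m A₀, tabZ m A₀, tabZ m A₁, tabZ m B₁, tabZ m B₀, tabZ m B₀, tabZ m B₁,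
    tabZ m C₁, tabZ m C₀, tabZ m C₀, tabZ m C₁, tabZ m A₁]

/-- Second factors. [this work] -/
def Y14 (m A₀ A₁ B₀ B₁ C₀ C₁ : ℕ) : Fin 14 → (Fin m → Bool) → ℤ :=
  ![tabZ m (fullN m), tabZ m (B₁ &&& C₁), tabZ m (B₁ &&& C₁), tabZ m B₁, tabZ m (B₀ &&& C₀), tabZ m (A₁ &&& C₁),
    tabZ m (A₁ &&& C₁), tabZ m A₁, tabZ m (A₀ &&& C₀), tabZ m (A₁ &&& B₁), tabZ m (A₁ &&& B₁), tabZ m A₁, tabZ m (A₀ &&& B₀), tabZ m B₁]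

/-- Third factors. [this work] -/
def Z14 (m _A₀ _A₁ _B₀ B₁ _C₀ C₁ : ℕ) : Fin 14 → (Fin m → Bool) → ℤ :=
  ![tabZ m (fullN m), tabZ m (fullN m), tabZ m (fullN m), tabZ m C₁, tabZ m (fullN m), tabZ m (fullN m), tabZ m (fullN m), tabZ m C₁,
    tabZ m (fullN m), tabZ m (fullN m), tabZ m (fullN m), tabZ m B₁, tabZ m (fullN m), tabZ m C₁]

set_option maxHeartbeats 1600000 in
/-- **Soundness of `checkSix`**: if the digit test passes, the tangent cubic of the bitmask tables is nonnegative at every point of the unit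
cube. [this work] -/
theorem checkSix_sound {σ m A₀ A₁ B₀ B₁ C₀ C₁ : ℕ} (h : checkSix σ m A₀ A₁ B₀ B₁ C₀ C₁ = true) {x : Fin m → ℝ} (hx : InCube x) :
    0 ≤ 2 * ML (tabR m (A₀ &&& B₀ &&& C₀)) x
      + (ML (tabR m A₁) x - ML (tabR m A₀) x) * ML (tabR m (B₁ &&& C₁)) x
      + (ML (tabR m B₁) x - ML (tabR m B₀) x) * ML (tabR m (A₁ &&& C₁)) x
      + (ML (tabR m C₁) x - ML (tabR m C₀) x) * ML (tabR m (A₁ &&& B₁)) x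
      + ML (tabR m A₀) x * ML (tabR m B₁) x * ML (tabR m C₁) x + ML (tabR m B₀) x * ML (tabR m A₁) x * ML (tabR m C₁) x
      + ML (tabR m C₀) x * ML (tabR m A₁) x * ML (tabR m B₁) x
      - ML (tabR m A₁) x * ML (tabR m (B₀ &&& C₀)) x - ML (tabR m B₁) x * ML (tabR m (A₀ &&& C₀)) x
      - ML (tabR m C₁) x * ML (tabR m (A₀ &&& B₀)) x
      - 2 * ML (tabR m A₁) x * ML (tabR m B₁) x * ML (tabR m C₁) x := by
  unfold checkSix checkSixW at h
  simp only [Bool.and_eq_true, decide_eq_true_eq] at h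
  obtain ⟨⟨hσ, hbnd⟩, hZ, hland⟩ := h
  have hoff : offT σ m = (maskN σ (4 ^ m) : ℤ) := by
    unfold offT
    rw [off_eq σ (4 ^ m) hσ, maskN_eq_sum σ hσ, Finset.mul_sum]
  rw [hoff] at hZ hland
  rw [Int.toNat_natCast] at hland
  have hZeq : zT3 σ m (krT σ m (fullN m)) A₀ A₁ B₀ B₁ C₀ C₁ =
      cubicZ (2 ^ σ) sgn14 (X14 m A₀ A₁ B₀ B₁ C₀ C₁) (Y14 m A₀ A₁ B₀ B₁ C₀ C₁) (Z14 m A₀ A₁ B₀ B₁ C₀ C₁) := by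
    unfold zT3 cubicZ
    simp only [Fin.sum_univ_succ, Fin.sum_univ_zero, sgn14, X14, Y14, Z14, Matrix.cons_val_zero, Matrix.cons_val_succ, krT_eq]
    ring
  have hB : CoefBound3 sgn14 (X14 m A₀ A₁ B₀ B₁ C₀ C₁) (Y14 m A₀ A₁ B₀ B₁ C₀ C₁) (Z14 m A₀ A₁ B₀ B₁ C₀ C₁) (2 ^ (σ - 1)) := by
    intro k
    have hX : ∀ j g, |X14 m A₀ A₁ B₀ B₁ C₀ C₁ j g| ≤ 1 := by intro j g; fin_cases j <;> exact abs_tabZ_le _ _ _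
    have hY : ∀ j g, |Y14 m A₀ A₁ B₀ B₁ C₀ C₁ j g| ≤ 1 := by intro j g; fin_cases j <;> exact abs_tabZ_le _ _ _
    have hZ' : ∀ j g, |Z14 m A₀ A₁ B₀ B₁ C₀ C₁ j g| ≤ 1 := by intro j g; fin_cases j <;> exact abs_tabZ_le _ _ _
    have h8 : ∀ j, |sgn14 j * pcoef3 (X14 m A₀ A₁ B₀ B₁ C₀ C₁ j) (Y14 m A₀ A₁ B₀ B₁ C₀ C₁ j) (Z14 m A₀ A₁ B₀ B₁ C₀ C₁ j) k|
        ≤ |sgn14 j| * 8 ^ m := by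
      intro j
      rw [abs_mul]
      exact mul_le_mul_of_nonneg_left (abs_pcoef3_le _ _ _ (hX j) (hY j) (hZ' j) k) (abs_nonneg _)
    have hsum : |cubicCoef sgn14 (X14 m A₀ A₁ B₀ B₁ C₀ C₁) (Y14 m A₀ A₁ B₀ B₁ C₀ C₁) (Z14 m A₀ A₁ B₀ B₁ C₀ C₁) k| ≤ 16 * 8 ^ m := by
      unfold cubicCoef
      calc |∑ j : Fin 14, sgn14 j * pcoef3 (X14 m A₀ A₁ B₀ B₁ C₀ C₁ j) (Y14 m A₀ A₁ B₀ B₁ C₀ C₁ j) (Z14 m A₀ A₁ B₀ B₁ C₀ C₁ j) k|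
          ≤ ∑ j : Fin 14, |sgn14 j * pcoef3 (X14 m A₀ A₁ B₀ B₁ C₀ C₁ j) (Y14 m A₀ A₁ B₀ B₁ C₀ C₁ j) (Z14 m A₀ A₁ B₀ B₁ C₀ C₁ j) k| :=
            Finset.abs_sum_le_sum_abs _ _
        _ ≤ ∑ j : Fin 14, |sgn14 j| * (8 : ℤ) ^ m := Finset.sum_le_sum fun j _ => h8 j
        _ = 16 * 8 ^ m := by simp [Fin.sum_univ_succ, sgn14]; ring
    have hpow : (16 : ℤ) * 8 ^ m < (2 : ℕ) ^ (σ - 1) := by exact_mod_cast hbnd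
    exact lt_of_le_of_lt hsum hpow
  set N : ℕ := (zT3 σ m (krT σ m (fullN m)) A₀ A₁ B₀ B₁ C₀ C₁ + maskN σ (4 ^ m)).toNat with hN
  have hNZ : (N : ℤ) = cubicZ (2 ^ σ) sgn14 (X14 m A₀ A₁ B₀ B₁ C₀ C₁) (Y14 m A₀ A₁ B₀ B₁ C₀ C₁) (Z14 m A₀ A₁ B₀ B₁ C₀ C₁) +
      ∑ j : Fin (4 ^ m), (2 : ℤ) ^ (σ - 1) * (2 ^ σ) ^ (j : ℕ) := by
    rw [hN, Int.toNat_of_nonneg hZ, hZeq, maskN_eq_sum σ hσ, Fin.sum_univ_eq_sum_range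
      (fun j => (2 : ℤ) ^ (σ - 1) * (2 ^ σ) ^ j) (4 ^ m)]
  have hdig : ∀ j : ℕ, j < 4 ^ m → 2 ^ (σ - 1) ≤ digit (2 ^ σ) N j := digit_ge_of_land σ hσ (4 ^ m) N hland
  have hk : ∀ k, 0 ≤ cubicCoef sgn14 (X14 m A₀ A₁ B₀ B₁ C₀ C₁) (Y14 m A₀ A₁ B₀ B₁ C₀ C₁) (Z14 m A₀ A₁ B₀ B₁ C₀ C₁) k :=
    cubicCoef_nonneg_of_digit_ge hσ hB N hNZ hdig
  have hF : 0 ≤ cubicForm sgn14 (X14 m A₀ A₁ B₀ B₁ C₀ C₁) (Y14 m A₀ A₁ B₀ B₁ C₀ C₁) (Z14 m A₀ A₁ B₀ B₁ C₀ C₁) x := cubicForm_nonneg hk hx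
  unfold cubicForm at hF
  simp only [Fin.sum_univ_succ, Fin.sum_univ_zero, sgn14, X14, Y14, Z14, Matrix.cons_val_zero, Matrix.cons_val_succ] at hF
  have h1 : ML (fun g => ((tabZ m (fullN m) g : ℤ) : ℝ)) x = 1 := ML_fullN m x
  rw [h1] at hF
  unfold tabR
  push_cast at hF
  linarith

/-! ## Increasing bitmask pairs and the cube check -/

/-- All pairs `(A₀, A₁)` of increasing bitmasks with `A₀ ⊆ A₁`, encoded as `A₀ * 2^(2^m) + A₁` (`20, 168` pairs for `m = 2, 3`). [this work] -/
def pairsN (m : ℕ) : List ℕ :=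
  ((upsN m).flatMap fun A₀ => (upsN m).map fun A₁ => (A₀, A₁)).filterMap fun P =>
    if P.1 &&& P.2 = P.1 then some (P.1 * 2 ^ (2 ^ m) + P.2) else none

/-- **The cube check for `T₃`**: the digit test for every sorted triple of increasing bitmask pairs (sharing `F` and the offset). [this work] -/
def checkCubeT (m σ : ℕ) : Bool :=
  let prs := pairsN m
  let M := 2 ^ (2 ^ m)
  let F : ℤ := krT σ m (fullN m)
  let off := offT σ m
  let offN := off.toNat
  decide (0 < σ) && decide (16 * 8 ^ m < 2 ^ (σ - 1)) &&
    prs.all fun P => prs.all fun Q => prs.all fun R =>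
      decide (Q < P) || decide (R < Q) || checkSixW σ m F off offN (P / M) (P % M) (Q / M) (Q % M) (R / M) (R % M)

/-- Membership in `pairsN`. [this work] -/
theorem mem_pairsN {m A₀ A₁ : ℕ} (h₀ : A₀ ∈ upsN m) (h₁ : A₁ ∈ upsN m) (hsub : A₀ &&& A₁ = A₀) :
    A₀ * 2 ^ (2 ^ m) + A₁ ∈ pairsN m := by
  unfold pairsN
  rw [List.mem_filterMap]
  refine ⟨(A₀, A₁), ?_, by simp [hsub]⟩
  rw [List.mem_flatMap]
  exact ⟨A₀, h₀, List.mem_map.2 ⟨A₁, h₁, rfl⟩⟩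

/-- Elements of `upsN m` are `< 2^(2^m)`. [this work] -/
theorem lt_of_mem_upsN {m A : ℕ} (h : A ∈ upsN m) : A < 2 ^ (2 ^ m) := by
  unfold upsN at h
  rw [List.mem_filter, List.mem_range] at h
  exact h.1

/-- `checkCubeT` certifies every sorted triple of increasing bitmask pairs. [this work] -/
theorem checkSix_of_checkCubeT {m σ : ℕ} (h : checkCubeT m σ = true) {A₀ A₁ B₀ B₁ C₀ C₁ : ℕ}
    (hA₀ : A₀ ∈ upsN m) (hA₁ : A₁ ∈ upsN m) (hB₀ : B₀ ∈ upsN m) (hB₁ : B₁ ∈ upsN m) (hC₀ : C₀ ∈ upsN m) (hC₁ : C₁ ∈ upsN m)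
    (hA : A₀ &&& A₁ = A₀) (hB : B₀ &&& B₁ = B₀) (hC : C₀ &&& C₁ = C₀)
    (hAB : A₀ * 2 ^ (2 ^ m) + A₁ ≤ B₀ * 2 ^ (2 ^ m) + B₁) (hBC : B₀ * 2 ^ (2 ^ m) + B₁ ≤ C₀ * 2 ^ (2 ^ m) + C₁) :
    checkSix σ m A₀ A₁ B₀ B₁ C₀ C₁ = true := by
  unfold checkCubeT at h
  simp only [Bool.and_eq_true, decide_eq_true_eq, List.all_eq_true, Bool.or_eq_true] at h
  obtain ⟨⟨hσ, hbnd⟩, hall⟩ := h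
  have := hall _ (mem_pairsN hA₀ hA₁ hA) _ (mem_pairsN hB₀ hB₁ hB) _ (mem_pairsN hC₀ hC₁ hC)
  have hM : 0 < 2 ^ (2 ^ m) := by positivity
  have e1 : ∀ {X₀ X₁ : ℕ}, X₁ ∈ upsN m → (X₀ * 2 ^ (2 ^ m) + X₁) / 2 ^ (2 ^ m) = X₀ := fun hX₁ => by
    rw [Nat.mul_comm, Nat.mul_add_div hM, Nat.div_eq_of_lt (lt_of_mem_upsN hX₁), Nat.add_zero]
  have e2 : ∀ {X₀ X₁ : ℕ}, X₁ ∈ upsN m → (X₀ * 2 ^ (2 ^ m) + X₁) % 2 ^ (2 ^ m) = X₁ := fun hX₁ => by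
    rw [Nat.mul_comm, Nat.mul_add_mod, Nat.mod_eq_of_lt (lt_of_mem_upsN hX₁)]
  rw [e1 hA₁, e2 hA₁, e1 hB₁, e2 hB₁, e1 hC₁, e2 hC₁] at this
  unfold checkSix
  simp only [Bool.and_eq_true, decide_eq_true_eq]
  refine ⟨⟨hσ, hbnd⟩, ?_⟩
  rcases this with (h1 | h2) | h3
  · exact absurd hAB (not_le.2 h1)
  · exact absurd hBC (not_le.2 h2)
  · exact h3

/-! ## From the check to the tangent inequality under `prodBernoulli` -/

open Classical in
/-- For `A₀ ⊆ A₁`, the bitmasks satisfy `encA A₀ &&& encA A₁ = encA A₀`. [this work] -/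
theorem encA_land_of_subset {m : ℕ} {A₀ A₁ : Set (Set (Fin m))} (h : A₀ ⊆ A₁) : encA m A₀ &&& encA m A₁ = encA m A₀ := by
  apply Nat.eq_of_testBit_eq
  intro x
  rw [Nat.testBit_land, testBit_encA, testBit_encA]
  by_cases hx : x < 2 ^ m
  · by_cases h₀ : pt m x ∈ A₀
    · simp [hx, h₀, h h₀]
    · simp [h₀]
  · simp [hx]

/-- `T₃ ≥ 0` for six events whose bitmasks pass `checkSix`, under every product measure. [this work] -/
theorem tangent_nonneg_of_checkSix {m σ : ℕ} (p : Fin m → unitInterval) {A₀ A₁ B₀ B₁ C₀ C₁ : Set (Set (Fin m))}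
    (h : checkSix σ m (encA m A₀) (encA m A₁) (encA m B₀) (encA m B₁) (encA m C₀) (encA m C₁) = true) :
    0 ≤ 2 * (prodBernoulli p).real (A₀ ∩ B₀ ∩ C₀)
      + ((prodBernoulli p).real A₁ - (prodBernoulli p).real A₀) * (prodBernoulli p).real (B₁ ∩ C₁)
      + ((prodBernoulli p).real B₁ - (prodBernoulli p).real B₀) * (prodBernoulli p).real (A₁ ∩ C₁)
      + ((prodBernoulli p).real C₁ - (prodBernoulli p).real C₀) * (prodBernoulli p).real (A₁ ∩ B₁)
      + (prodBernoulli p).real A₀ * (prodBernoulli p).real B₁ * (prodBernoulli p).real C₁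
      + (prodBernoulli p).real B₀ * (prodBernoulli p).real A₁ * (prodBernoulli p).real C₁
      + (prodBernoulli p).real C₀ * (prodBernoulli p).real A₁ * (prodBernoulli p).real B₁
      - (prodBernoulli p).real A₁ * (prodBernoulli p).real (B₀ ∩ C₀) - (prodBernoulli p).real B₁ * (prodBernoulli p).real (A₀ ∩ C₀)
      - (prodBernoulli p).real C₁ * (prodBernoulli p).real (A₀ ∩ B₀)
      - 2 * (prodBernoulli p).real A₁ * (prodBernoulli p).real B₁ * (prodBernoulli p).real C₁ := by
  classical
  have hx : InCube (fun i => (p i : ℝ)) := fun i => ⟨(p i).2.1, (p i).2.2⟩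
  have key := checkSix_sound h hx
  have e : ∀ X : Set (Set (Fin m)), (prodBernoulli p).real X = ML (tabR m (encA m X)) (fun i => (p i : ℝ)) :=
    real_eq_ML_cube p
  simp only [e]
  simp only [tabR_encA_inter, tabR_land] at key ⊢
  exact key

/-- **The tangent inequality on the `m`-cube from the cube check.**  If `checkCubeT m σ = true` then for every product measure
`prodBernoulli p`, `p : Fin m → [0,1]`, and all increasing events `A₀ ⊆ A₁`, `B₀ ⊆ B₁`, `C₀ ⊆ C₁` of `Set (Fin m)` (the section pairs of three
increasing events of `{0,1}^m × Bool`): `T₃ ≥ 0`. [this work] -/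
theorem tangent_cube_nonneg_of_checkCubeT {m σ : ℕ} (h : checkCubeT m σ = true) (p : Fin m → unitInterval)
    {A₀ A₁ B₀ B₁ C₀ C₁ : Set (Set (Fin m))} (hA₀ : IsUpperSet A₀) (hA₁ : IsUpperSet A₁) (hB₀ : IsUpperSet B₀) (hB₁ : IsUpperSet B₁)
    (hC₀ : IsUpperSet C₀) (hC₁ : IsUpperSet C₁) (hA : A₀ ⊆ A₁) (hB : B₀ ⊆ B₁) (hC : C₀ ⊆ C₁) :
    0 ≤ 2 * (prodBernoulli p).real (A₀ ∩ B₀ ∩ C₀)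
      + ((prodBernoulli p).real A₁ - (prodBernoulli p).real A₀) * (prodBernoulli p).real (B₁ ∩ C₁)
      + ((prodBernoulli p).real B₁ - (prodBernoulli p).real B₀) * (prodBernoulli p).real (A₁ ∩ C₁)
      + ((prodBernoulli p).real C₁ - (prodBernoulli p).real C₀) * (prodBernoulli p).real (A₁ ∩ B₁)
      + (prodBernoulli p).real A₀ * (prodBernoulli p).real B₁ * (prodBernoulli p).real C₁
      + (prodBernoulli p).real B₀ * (prodBernoulli p).real A₁ * (prodBernoulli p).real C₁
      + (prodBernoulli p).real C₀ * (prodBernoulli p).real A₁ * (prodBernoulli p).real B₁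
      - (prodBernoulli p).real A₁ * (prodBernoulli p).real (B₀ ∩ C₀) - (prodBernoulli p).real B₁ * (prodBernoulli p).real (A₀ ∩ C₀)
      - (prodBernoulli p).real C₁ * (prodBernoulli p).real (A₀ ∩ B₀)
      - 2 * (prodBernoulli p).real A₁ * (prodBernoulli p).real B₁ * (prodBernoulli p).real C₁ := by
  -- symmetric in the three pairs: sort them by their pair code and apply the check
  let S := {P : Set (Set (Fin m)) × Set (Set (Fin m)) // IsUpperSet P.1 ∧ IsUpperSet P.2 ∧ P.1 ⊆ P.2}
  let μ := prodBernoulli p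
  let T : S → S → S → Prop := fun a b c =>
    0 ≤ 2 * μ.real (a.1.1 ∩ b.1.1 ∩ c.1.1)
      + (μ.real a.1.2 - μ.real a.1.1) * μ.real (b.1.2 ∩ c.1.2) + (μ.real b.1.2 - μ.real b.1.1) * μ.real (a.1.2 ∩ c.1.2)
      + (μ.real c.1.2 - μ.real c.1.1) * μ.real (a.1.2 ∩ b.1.2)
      + μ.real a.1.1 * μ.real b.1.2 * μ.real c.1.2 + μ.real b.1.1 * μ.real a.1.2 * μ.real c.1.2 + μ.real c.1.1 * μ.real a.1.2 * μ.real b.1.2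
      - μ.real a.1.2 * μ.real (b.1.1 ∩ c.1.1) - μ.real b.1.2 * μ.real (a.1.1 ∩ c.1.1) - μ.real c.1.2 * μ.real (a.1.1 ∩ b.1.1)
      - 2 * μ.real a.1.2 * μ.real b.1.2 * μ.real c.1.2
  have key : T ⟨(A₀, A₁), hA₀, hA₁, hA⟩ ⟨(B₀, B₁), hB₀, hB₁, hB⟩ ⟨(C₀, C₁), hC₀, hC₁, hC⟩ := by
    refine forall_of_sorted T (fun a => encA m a.1.1 * 2 ^ (2 ^ m) + encA m a.1.2) ?_ ?_ ?_ _ _ _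
    · intro a b c habc
      simp only [T, Set.inter_comm, Set.inter_left_comm] at habc ⊢
      linarith
    · intro a b c habc
      simp only [T, Set.inter_comm, Set.inter_left_comm] at habc ⊢
      linarith
    · intro a b c hab hbc
      exact tangent_nonneg_of_checkSix p (checkSix_of_checkCubeT h (encA_mem_upsN a.2.1) (encA_mem_upsN a.2.2.1)
        (encA_mem_upsN b.2.1) (encA_mem_upsN b.2.2.1) (encA_mem_upsN c.2.1) (encA_mem_upsN c.2.2.1)
        (encA_land_of_subset a.2.2.2) (encA_land_of_subset b.2.2.2) (encA_land_of_subset c.2.2.2) hab hbc)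
  exact key

end Summit.CriticalPhenomena.PercolationContinuityZ3.Theorems.SahiTangent
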